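import Summits.AnomalousDissipation.AnomalousDissipation.Theorems.ScalarAnomalySteadySourceFormal.Negative.WienBand

/-!
# Negative knowledge for the crux `ScalarAnomalySteadySourceFormal` (stmt-AnomalousDissipation-0448), X-d:
# Wiener-class stirring — the boundary flux of a square band, shift by shift

Certified copy of §12.4 of the cdisprove work file.  The boundary flux `wBdryFlux` of the square band
`sbox K' \\ sbox K` is bounded SHIFT BY SHIFT: the shift `q` only moves modes across the layer of
half-width `r_q = |q|_∞` around `|p|_∞ = K` (inner, weight `K + r_q`) or `K'` (outer, weight
`K' + r_q`), so (`norm_wBdryFlux_le_tsum`, a corollary of `Negative.CellFlux.cell_sum_boundary_le`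
applied with `R = r_q`, `M = a_q`):
`‖wBdryFlux‖ ≤ ∑' q, 2 a_q ((K + r_q) · slayerSum (K-r_q) (K+r_q) Y + (K' + r_q) · slayerSum (K'-r_q) (K'+r_q) Y)`,
the series converging as soon as `∑ r_q a_q < ∞` and the finite sums `∑_{p∈F} ‖Y p‖²` are bounded
(`V`, Bessel).  Only this FIRST MOMENT of the majorant enters here; the second moment enters the
harmonic pigeonhole downstream.

Supports stmt-AnomalousDissipation-0448 (the Wiener-class no-go, files `Wien*`).
-/

set_option linter.dupNamespace false

noncomputable section

open scoped BigOperators Topology ENNReal NNReal InnerProductSpace ContDiff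
open Filter Set Function MeasureTheory UnitAddTorus Complex

namespace Summit.AnomalousDissipation.AnomalousDissipation.Theorems.ScalarAnomalySteadySourceFormal.Negative

open Literature.Analysis
open Literature.Analysis.FunctionSpaces Literature.Analysis.FunctionSpaces.Torus
open Literature.Analysis.FluidPDE Literature.Analysis.FluidPDE.Torus

/-- The frequency lattice `ℤ²` (local notation). -/
local notation "ℤ²" => Fin 2 → ℤ

section ShiftRadius

/-- The sup-radius of a shift, `r_q = max |q 0| |q 1|` (as a natural number). [folklore] -/
def qrad (q : ℤ²) : ℕ := max (q 0).natAbs (q 1).natAbs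

/-- `|q 0| ≤ r_q`. [folklore] -/
theorem abs_apply_zero_le_qrad (q : ℤ²) : |q 0| ≤ (qrad q : ℤ) := by
  unfold qrad; push_cast; rw [← Int.natCast_natAbs]; exact_mod_cast le_max_left _ _

/-- `|q 1| ≤ r_q`. [folklore] -/
theorem abs_apply_one_le_qrad (q : ℤ²) : |q 1| ≤ (qrad q : ℤ) := by
  unfold qrad; push_cast; rw [← Int.natCast_natAbs]; exact_mod_cast le_max_right _ _

/-- `r_q ≤ |q 0| + |q 1|` (in `ℝ`). [folklore] -/
theorem qrad_le_add (q : ℤ²) : (qrad q : ℝ) ≤ |(q 0 : ℝ)| + |(q 1 : ℝ)| := by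
  have h0 : ((q 0).natAbs : ℝ) = |(q 0 : ℝ)| := by rw [Nat.cast_natAbs, Int.cast_abs]
  have h1 : ((q 1).natAbs : ℝ) = |(q 1 : ℝ)| := by rw [Nat.cast_natAbs, Int.cast_abs]
  unfold qrad
  rcases le_total (q 0).natAbs (q 1).natAbs with h | h
  · rw [max_eq_right h, h1]; linarith [abs_nonneg ((q 0 : ℤ) : ℝ)]
  · rw [max_eq_left h, h0]; linarith [abs_nonneg ((q 1 : ℤ) : ℝ)]

end ShiftRadius

section WFlux

variable {C : ℤ² → EuclideanSpace ℂ (Fin 2)} {a : ℤ² → ℝ} {Y : ℤ² → ℂ} {B V : ℝ}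

/-- `slayerSum ≤ V` when all finite sums of `‖Y p‖²` are `≤ V`. [folklore] -/
theorem slayerSum_le_of_bessel (hV : ∀ F : Finset ℤ², ∑ p ∈ F, ‖Y p‖ ^ 2 ≤ V) (lo hi : ℤ) :
    slayerSum lo hi Y ≤ V := hV _

/-- The shift-by-shift bound function of the flux. [folklore] -/
def wFluxBound (a : ℤ² → ℝ) (K K' : ℤ) (Y : ℤ² → ℂ) (q : ℤ²) : ℝ :=
  2 * a q * ((K + qrad q) * slayerSum (K - qrad q) (K + qrad q) Y + (K' + qrad q) * slayerSum (K' - qrad q) (K' + qrad q) Y)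

/-- `wFluxBound ≥ 0`. [folklore] -/
theorem wFluxBound_nonneg (ha : ∀ q, 0 ≤ a q) {K K' : ℤ} (hK : 0 ≤ K) (hK' : 0 ≤ K') (Y : ℤ² → ℂ) (q : ℤ²) :
    0 ≤ wFluxBound a K K' Y q := by
  unfold wFluxBound
  have := ha q; have := slayerSum_nonneg (K - qrad q) (K + qrad q) Y; have := slayerSum_nonneg (K' - qrad q) (K' + qrad q) Y
  have hK0 : (0 : ℝ) ≤ K := by exact_mod_cast hK
  have hK'0 : (0 : ℝ) ≤ K' := by exact_mod_cast hK'
  positivity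

/-- `wFluxBound ≤ 2 a_q (K + K' + 2 r_q) V` — summable when `∑ r_q a_q < ∞`. [folklore] -/
theorem wFluxBound_le (ha : ∀ q, 0 ≤ a q) (hV : ∀ F : Finset ℤ², ∑ p ∈ F, ‖Y p‖ ^ 2 ≤ V) {K K' : ℤ}
    (hK : 0 ≤ K) (hK' : 0 ≤ K') (q : ℤ²) :
    wFluxBound a K K' Y q ≤ 2 * (K + K') * V * a q + 4 * V * (qrad q * a q) := by
  unfold wFluxBound
  have hV0 : 0 ≤ V := (Finset.sum_nonneg fun _ _ => sq_nonneg _).trans (hV ∅)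
  have h1 := slayerSum_le_of_bessel hV (K - qrad q) (K + qrad q)
  have h2 := slayerSum_le_of_bessel hV (K' - qrad q) (K' + qrad q)
  have hK0 : (0 : ℝ) ≤ K := by exact_mod_cast hK
  have hK'0 : (0 : ℝ) ≤ K' := by exact_mod_cast hK'
  have haq := ha q
  have hr : (0 : ℝ) ≤ qrad q := (qrad q).cast_nonneg
  have e1 : (K + qrad q) * slayerSum (K - qrad q) (K + qrad q) Y ≤ (K + qrad q) * V := mul_le_mul_of_nonneg_left h1 (by positivity)
  have e2 : (K' + qrad q) * slayerSum (K' - qrad q) (K' + qrad q) Y ≤ (K' + qrad q) * V := mul_le_mul_of_nonneg_left h2 (by positivity)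
  nlinarith [e1, e2, haq, hV0, hr]

/-- Summability of the flux bound in the shift (first moment of the majorant). [folklore] -/
theorem summable_wFluxBound (ha : ∀ q, 0 ≤ a q) (hsa : Summable a) (hsa1 : Summable fun q => (qrad q : ℝ) * a q)
    (hV : ∀ F : Finset ℤ², ∑ p ∈ F, ‖Y p‖ ^ 2 ≤ V) {K K' : ℤ} (hK : 0 ≤ K) (hK' : 0 ≤ K') :
    Summable fun q => wFluxBound a K K' Y q :=
  Summable.of_nonneg_of_le (wFluxBound_nonneg ha hK hK' Y) (wFluxBound_le ha hV hK hK')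
    ((hsa.mul_left _).add (hsa1.mul_left _))

/-- **Shift-by-shift boundary flux bound for the square band** (Wiener-class stirring):
`‖wBdryFlux‖ ≤ ∑' q, 2 a_q ((K + r_q)·slayerSum (K-r_q) (K+r_q) Y + (K' + r_q)·slayerSum (K'-r_q) (K'+r_q) Y)`. [folklore] -/
theorem norm_wBdryFlux_le_tsum {K K' : ℤ} (hK : 0 ≤ K) (hK' : 0 ≤ K') (hCa : ∀ q, ‖C q‖ ≤ a q) (hsa : Summable a)
    (hsa1 : Summable fun q => (qrad q : ℝ) * a q) (hY : ∀ q, ‖Y q‖ ≤ B)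
    (hV : ∀ F : Finset ℤ², ∑ p ∈ F, ‖Y p‖ ^ 2 ≤ V) :
    ‖wBdryFlux (box K' K' \ box K K) C Y‖ ≤ ∑' q, wFluxBound a K K' Y q := by
  classical
  have ha : ∀ q, 0 ≤ a q := fun q => (norm_nonneg _).trans (hCa q)
  have hs : Summable fun q => ‖C q‖ := Summable.of_nonneg_of_le (fun _ => norm_nonneg _) hCa hsa
  set 𝔅 := box K' K' \ box K K with h𝔅
  -- per shift: the `cell_sum_boundary_le` corollary
  have hq : ∀ q, ∑ p ∈ 𝔅, ‖if p - q ∈ 𝔅 then (0 : ℂ) else wTerm C Y p q‖ ≤ wFluxBound a K K' Y q := by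
    intro q
    have e : ∀ p ∈ 𝔅, ‖if p - q ∈ 𝔅 then (0 : ℂ) else wTerm C Y p q‖ =
        if p - q ∈ 𝔅 then 0 else ‖zdot p (C q) * Y (p - q) * (starRingEnd ℂ) (Y p)‖ := by
      intro p _; split_ifs <;> simp [wTerm]
    rw [Finset.sum_congr rfl e]
    have h1 := cell_sum_boundary_le (R := qrad q) hK hK' (m := q) (abs_apply_zero_le_qrad q) (abs_apply_one_le_qrad q)
      (hCa q) (ha q) Y
    exact h1.trans (le_of_eq (by rw [wFluxBound]))
  -- swap the finite sum and the series, then compare termwise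
  have hsw : ∑ p ∈ 𝔅, ∑' q, ‖if p - q ∈ 𝔅 then (0 : ℂ) else wTerm C Y p q‖ =
      ∑' q, ∑ p ∈ 𝔅, ‖if p - q ∈ 𝔅 then (0 : ℂ) else wTerm C Y p q‖ :=
    (Summable.tsum_finsetSum fun p _ => (summable_wTerm_ite hs hY 𝔅 p).norm).symm
  calc ‖wBdryFlux 𝔅 C Y‖ ≤ ∑ p ∈ 𝔅, ∑' q, ‖if p - q ∈ 𝔅 then (0 : ℂ) else wTerm C Y p q‖ :=
        norm_wBdryFlux_le_tsum_norm hs hY 𝔅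
    _ = ∑' q, ∑ p ∈ 𝔅, ‖if p - q ∈ 𝔅 then (0 : ℂ) else wTerm C Y p q‖ := hsw
    _ ≤ ∑' q, wFluxBound a K K' Y q :=
        Summable.tsum_le_tsum hq (summable_sum fun p _ => (summable_wTerm_ite hs hY 𝔅 p).norm)
          (summable_wFluxBound ha hsa hsa1 hV hK hK')

end WFlux

end Summit.AnomalousDissipation.AnomalousDissipation.Theorems.ScalarAnomalySteadySourceFormal.Negative
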